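import Literature.Computability.AlgebraicComplexity.GlobalStageCompatProduct
import Literature.Computability.AlgebraicComplexity.SalemSpencerModular
import Mathlib.NumberTheory.Bertrand
import HarnessLib

/-!
# Choosing the hashing parameters: the modulus `M` (Bertrand) and the Salem–Spencer set `B`
(Behrend), and the one-region Prop. 5.1 with all requirements discharged
(Vassilevska Williams–Xu–Xu–Zhou 2024, §5.2 and §5.6) — proved

Topic `Literature/Computability/AlgebraicComplexity`.  §5.2/§5.6 of Vassilevska Williams–Xu–Xu–Zhou
(SODA 2024, arXiv:2307.07970) choose: "`M` a prime number in the range `[M₀, 2M₀]` whose value we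
will specify later", "a Salem–Spencer set `B` of size `M^{1-o(1)}`", and finally
"`M₀ = max{8 numtriple/numxblock, 8 numtriple/numyblock, (numalpha · p_comp / numzblock) · 80N}`".
This file PROVES, for well-formed and symmetric data `D` of one region (with a triple `T₀ ∈ 𝒯α` and
a typical pair `p₀`, so that the common values `M_Z = usefulZCount` and `V = |compatTriples p₀|` of
`GlobalStageCompatCount.lean` make sense), that such parameters EXIST and meet every counting
requirement of the exact one-region Prop. 5.1 (`vxxz2024_prop51_region'`):

* `usefulZCount_eq_of_mem` — `M_Z(T)` does not depend on `T ∈ 𝒯α` (symmetry);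
* `modulusBound` — `M₀ = max{8|𝒯|/|X-blocks| + 1, 8|𝒯|/|Y-blocks| + 1, 160 N V, 2c + 2}` (the printed
  `M₀` with the constant of the hole requirement adapted to the exact form `10 U ≤ (h+1) M`,
  `h = ⌊M_Z / 8N⌋`, `U ≤ M_Z V`);
* `vxxz2024_prop51_region_parameters` — **there are a prime `M` with `M₀ < M ≤ 2M₀` (Bertrand) and
  a set `B ⊆ ℤ/M` without non-trivial 3-term progressions, `|B| ≥ (M/2) e^{-4√(log M)}` (Behrend,
  `advxxz2025_thm37`), such that `(CW_q^{⊗c})^{⊗n} ≥ ⟨⌊|B| · |𝒯α| / (2M²r)⌋⟩ ⊗ 𝒯*_{T₀}`** for every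
  `r ≥ 8^{3⌊log_{2N} 3^N⌋+3}` — all requirements (`M` odd prime `> 2c`, cleanup, holes, hole budget)
  discharged from the choice of `M₀`.

Everything is proved; one definition (`modulusBound`); no named facts.  Turning `|𝒯α|`, `M₀`, `|B|`,
`r` into the exponent `E₁` (entropies) is not part of this file.

## References

* V. Vassilevska Williams, Y. Xu, Z. Xu, R. Zhou, *New bounds for matrix multiplication: from alpha
  to omega*, SODA 2024, arXiv:2307.07970 (held: `paper:arxiv-2307.07970`), §5.2 (choice of `M`, `B`)
  and §5.6 (the final constraint on `M₀`). [VassilevskaWilliamsXuXuZhou2024]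
-/

noncomputable section

open scoped BigOperators
open Finset

namespace Literature.Computability.AlgebraicComplexity

open Literature.Barriers.MatrixMultiplication (bigCwTensor)

namespace GlobalStageData

open scoped Classical

universe u

variable {c n M : ℕ} {D : GlobalStageData c n M}

/-- `M_Z` is `S_n`-invariant. [cite: VassilevskaWilliamsXuXuZhou2024, Claim 5.14 (proof, "by symmetry")] -/
theorem usefulZCount_permT (σ : Equiv.Perm (Fin n))
    (T : (Fin n → Fin (2 * c + 1)) × (Fin n → Fin (2 * c + 1)) × (Fin n → Fin (2 * c + 1))) :
    D.usefulZCount (permT σ T) = D.usefulZCount T := by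
  unfold usefulZCount
  symm
  refine Finset.card_equiv (Equiv.arrowCongr σ.symm (Equiv.refl _)) fun Kh => ?_
  simp only [mem_filter, mem_univ, true_and]
  have e : (Equiv.arrowCongr σ.symm (Equiv.refl (Fin c → Fin 3))) Kh = Kh ∘ σ := by
    funext t; simp [Equiv.arrowCongr_apply]
  rw [e]
  have hu : D.UsefulZ (permT σ T) (Kh ∘ σ) ↔ D.UsefulZ T Kh :=
    isUsefulFor_comp_iff D.γZ (seqVal T.1) (seqVal T.2.1) (seqVal T.2.2) Kh σ
  rw [hu]
  constructor
  · rintro ⟨hb, hc⟩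
    exact ⟨by rw [← show (blockOfSeq Kh) ∘ σ = blockOfSeq (Kh ∘ σ) from rfl, hb], hc⟩
  · rintro ⟨hb, hc⟩
    refine ⟨?_, hc⟩
    have hb' : (blockOfSeq Kh) ∘ σ = T.2.2 ∘ σ := hb
    exact comp_perm_injective σ hb'

/-- **`M_Z(T)` does not depend on the triple of `𝒯α`.** [cite: VassilevskaWilliamsXuXuZhou2024, Claim 5.14 (proof)] -/
theorem usefulZCount_eq_of_mem (hS : D.Symmetric)
    {T T' : (Fin n → Fin (2 * c + 1)) × (Fin n → Fin (2 * c + 1)) × (Fin n → Fin (2 * c + 1))}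
    (hT : T ∈ D.𝒯α) (hT' : T' ∈ D.𝒯α) : D.usefulZCount T = D.usefulZCount T' := by
  obtain ⟨σ, hσ⟩ := hS.trans T hT T' hT'
  rw [← hσ, usefulZCount_permT]

variable (D)

/-- **The bound `M₀` on the modulus** (§5.6, with the constants of the exact form):
`max{8|𝒯|/|typeClass μX| + 1, 8|𝒯|/|typeClass μY| + 1, 160 · N · V, 2c + 2}`, `N = cn`,
`V = |compatTriples p₀|`. [cite: VassilevskaWilliamsXuXuZhou2024, §5.6 ("we will set M₀ to be max{8numtriple/numxblock, 8numtriple/numyblock, (numalpha·p_comp/numzblock)·80N}")] -/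
def modulusBound (p₀ : (Fin n → Fin (2 * c + 1)) × (Fin n → Fin c → Fin 3)) : ℕ :=
  max (max (8 * D.tripleSet.card / (typeClass n D.μX).card + 1) (8 * D.tripleSet.card / (typeClass n D.μY).card + 1))
    (max (160 * (c * n) * (D.compatTriples p₀.1 p₀.2).card) (2 * c + 2))

variable {D}

/-- The pairwise form of "no non-trivial 3-term progression" implies `ThreeAPFree`. [folklore] -/
theorem threeAPFree_of_pairwise {M : ℕ} {B : Finset (ZMod M)}
    (h : ∀ a ∈ B, ∀ b ∈ B, ∀ c ∈ B, a + b = c + c → a = c ∧ b = c) : ThreeAPFree (B : Set (ZMod M)) := by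
  intro a ha b hb d hd habd
  exact (h a (mem_coe.1 ha) d (mem_coe.1 hd) b (mem_coe.1 hb) habd).1

/-- **VXXZ Prop. 5.1, one region, with the hashing parameters chosen.**  For well-formed symmetric data
`D` of one region (`c, n ≥ 1`), a triple `T₀ ∈ 𝒯α` and a typical pair `p₀`: there are a prime `M`
with `M₀ < M ≤ 2M₀` (`M₀ = modulusBound`, Bertrand's postulate) and `B ⊆ ℤ/M` free of non-trivial
3-term progressions with `|B| ≥ (M/2) e^{-4√(log M)}` (Behrend) such that, for every
`r ≥ 8^{3⌊log_{2N} 3^N⌋+3}`, `(CW_q^{⊗c})^{⊗n} ≥ ⟨⌊|B| |𝒯α| / (2M²r)⌋⟩ ⊗ 𝒯*_{T₀}` — the requirements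
of `vxxz2024_prop51_region'` (cleanup `8|𝒯| ≤ M|X-blocks|`, holes `10U ≤ (h+1)M` with
`h = ⌊M_Z/8N⌋` via `U ≤ M_Z V`, hole budget `8Nh ≤ M_Z`) all following from `M > M₀`.
[cite: VassilevskaWilliamsXuXuZhou2024, Prop. 5.1, §5.2 and §5.6] -/
theorem vxxz2024_prop51_region_parameters {M₁ : ℕ} (D : GlobalStageData c n M₁) (hD : D.WellFormed)
    (hS : D.Symmetric) (R : Type u) [CommSemiring R] (q : ℕ) (hc : 0 < c) (hn : 0 < n)
    {T₀ : (Fin n → Fin (2 * c + 1)) × (Fin n → Fin (2 * c + 1)) × (Fin n → Fin (2 * c + 1))} (hT₀ : T₀ ∈ D.𝒯α)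
    {p₀ : (Fin n → Fin (2 * c + 1)) × (Fin n → Fin c → Fin 3)} (hp₀ : p₀ ∈ D.typicalPairs) :
    ∃ (M : ℕ) (B : Finset (ZMod M)), M.Prime ∧ D.modulusBound p₀ < M ∧ M ≤ 2 * D.modulusBound p₀ ∧
      ThreeAPFree (B : Set (ZMod M)) ∧ (M : ℝ) / 2 * Real.exp (-4 * Real.sqrt (Real.log M)) ≤ B.card ∧
      ∀ {r : ℕ}, 8 ^ (3 * Nat.log (2 * (c * n)) (3 ^ (c * n)) + 3) ≤ r →
        TensorRestrictsTo (kroneckerPow (kroneckerPow (bigCwTensor R q) c) n)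
          (kroneckerTensor (unitTensor R (B.card * D.𝒯α.card / (2 * M ^ 2 * r))) (D.starTensor R q T₀)) := by
  set M₀ := D.modulusBound p₀ with hM₀
  have hM₀pos : M₀ ≠ 0 := by
    have : 2 * c + 2 ≤ M₀ := le_max_of_le_right (le_max_right _ _)
    omega
  -- Bertrand: a prime `M₀ < M ≤ 2 M₀`
  obtain ⟨M, hMprime, hM₀M, hM2M₀⟩ := Nat.exists_prime_lt_and_le_two_mul M₀ hM₀pos
  -- Behrend: a Salem–Spencer set modulo `M`
  haveI : NeZero M := ⟨hMprime.ne_zero⟩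
  obtain ⟨B, hBcard, hBfree'⟩ := advxxz2025_thm37 M
  have hBfree : ThreeAPFree (B : Set (ZMod M)) := threeAPFree_of_pairwise hBfree'
  refine ⟨M, B, hMprime, hM₀M, hM2M₀, hBfree, hBcard, fun {r} hr => ?_⟩
  -- the data with the chosen set `B`
  haveI : Fact M.Prime := ⟨hMprime⟩
  let D' : GlobalStageData c n M := { D with B := B }
  have hD' : D'.WellFormed := ⟨hD.subset, hD.alphaConsistent, hD.revX, hD.revY⟩
  -- the requirements
  have h2c2 : 2 * c + 2 ≤ M₀ := le_max_of_le_right (le_max_right _ _)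
  have hM2 : M ≠ 2 := by omega
  have hcM : 2 * c < M := by omega
  have hT₀𝒯 : T₀ ∈ D.tripleSet := hD.subset hT₀
  have hXne : 0 < (typeClass n D.μX).card :=
    card_pos.2 ⟨T₀.1, mem_typeClass.2 (mem_typedSupport.1 hT₀𝒯).1⟩
  have hYne : 0 < (typeClass n D.μY).card :=
    card_pos.2 ⟨T₀.2.1, mem_typeClass.2 (mem_typedSupport.1 hT₀𝒯).2.1⟩
  have h8X : 8 * D'.tripleSet.card ≤ M * (typeClass n D'.μX).card := by
    show 8 * D.tripleSet.card ≤ M * (typeClass n D.μX).card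
    have h1 : 8 * D.tripleSet.card / (typeClass n D.μX).card + 1 ≤ M₀ := le_max_of_le_left (le_max_left _ _)
    have h2 : 8 * D.tripleSet.card < (8 * D.tripleSet.card / (typeClass n D.μX).card + 1) * (typeClass n D.μX).card :=
      Nat.lt_div_mul_add hXne |>.trans_le (by rw [Nat.add_mul, one_mul])
    calc 8 * D.tripleSet.card ≤ (8 * D.tripleSet.card / (typeClass n D.μX).card + 1) * (typeClass n D.μX).card := h2.le
      _ ≤ M * (typeClass n D.μX).card := Nat.mul_le_mul_right _ (by omega)
  have h8Y : 8 * D'.tripleSet.card ≤ M * (typeClass n D'.μY).card := by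
    show 8 * D.tripleSet.card ≤ M * (typeClass n D.μY).card
    have h1 : 8 * D.tripleSet.card / (typeClass n D.μY).card + 1 ≤ M₀ := le_max_of_le_left (le_max_right _ _)
    have h2 : 8 * D.tripleSet.card < (8 * D.tripleSet.card / (typeClass n D.μY).card + 1) * (typeClass n D.μY).card :=
      Nat.lt_div_mul_add hYne |>.trans_le (by rw [Nat.add_mul, one_mul])
    calc 8 * D.tripleSet.card ≤ (8 * D.tripleSet.card / (typeClass n D.μY).card + 1) * (typeClass n D.μY).card := h2.le
      _ ≤ M * (typeClass n D.μY).card := Nat.mul_le_mul_right _ (by omega)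
  -- the hole requirement with `h = ⌊M_Z / 8N⌋`
  set Z := D.usefulZCount T₀ with hZ
  set V := (D.compatTriples p₀.1 p₀.2).card with hV
  set h := Z / (8 * (c * n)) with hh
  have hN : 0 < 8 * (c * n) := by positivity
  have hZlt : Z < (h + 1) * (8 * (c * n)) := by
    rw [hh]; exact Nat.lt_div_mul_add hN |>.trans_le (by rw [Nat.add_mul, one_mul])
  have hMV : 160 * (c * n) * V ≤ M := (le_max_of_le_right (le_max_left _ _) : 160 * (c * n) * V ≤ M₀).trans hM₀M.le
  have hS' : D'.Symmetric := ⟨hS.perm_mem, hS.trans⟩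
  have hU : ∀ T ∈ D'.𝒯α, 10 * ((D'.holePairs T).card * M ^ (n - 1)) ≤ (h + 1) * M ^ n := by
    intro T hT
    have hTα : T ∈ D.𝒯α := hT
    have hUle : (D'.holePairs T).card ≤ D'.usefulZCount T * (D'.compatTriples p₀.1 p₀.2).card :=
      card_holePairs_le hD' hS' hT hp₀
    have hZT : D'.usefulZCount T = Z := usefulZCount_eq_of_mem hS hTα hT₀
    rw [hZT] at hUle
    have hV' : (D'.compatTriples p₀.1 p₀.2).card = V := rfl
    rw [hV'] at hUle
    have hn' : M ^ n = M * M ^ (n - 1) := by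
      rw [← pow_succ']; congr 1; omega
    rw [hn']
    -- `10 Z V ≤ (h+1) M`
    have key : 10 * (Z * V) ≤ (h + 1) * M := by
      calc 10 * (Z * V) ≤ 10 * ((h + 1) * (8 * (c * n)) * V) :=
            Nat.mul_le_mul_left _ (Nat.mul_le_mul_right _ hZlt.le)
        _ = (h + 1) * (80 * (c * n) * V) := by ring
        _ ≤ (h + 1) * (160 * (c * n) * V) := Nat.mul_le_mul_left _ (Nat.mul_le_mul_right _ (Nat.mul_le_mul_right _ (by norm_num)))
        _ ≤ (h + 1) * M := Nat.mul_le_mul_left _ hMV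
    calc 10 * ((D'.holePairs T).card * M ^ (n - 1)) ≤ 10 * (Z * V * M ^ (n - 1)) :=
          Nat.mul_le_mul_left _ (Nat.mul_le_mul_right _ hUle)
      _ = 10 * (Z * V) * M ^ (n - 1) := by ring
      _ ≤ (h + 1) * M * M ^ (n - 1) := Nat.mul_le_mul_right _ key
      _ = (h + 1) * (M * M ^ (n - 1)) := by ring
  have hhZ : ∀ T ∈ D'.𝒯α, 8 * (c * n) * h ≤ D'.usefulZCount T := by
    intro T hT
    have hTα : T ∈ D.𝒯α := hT
    rw [show D'.usefulZCount T = Z from usefulZCount_eq_of_mem hS hTα hT₀, hh]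
    exact Nat.mul_div_le Z (8 * (c * n)) |> fun h' => by rw [mul_comm]; exact Nat.div_mul_le_self Z _
  have hT₀' : T₀ ∈ D'.𝒯α := hT₀
  have := vxxz2024_prop51_region' hD' R q hM2 hcM hc hn hBfree h8X h8Y hU hhZ hr hT₀'
  exact this

end GlobalStageData

end Literature.Computability.AlgebraicComplexity
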